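import Summits.QuantumFields.YangMills.Theorems.VirialFluxGapResolventFieldMatrix
import Mathlib.Analysis.Calculus.Deriv.Mul
import Mathlib.Analysis.Calculus.Deriv.Inv
import Mathlib.Analysis.Calculus.Deriv.Add
import Mathlib.LinearAlgebra.Matrix.Adjugate
import HarnessLib

/-!
# Route `VirialFluxGap` (YangMills): the RESOLVENT EULER FIELD — one-variable calculus of the coefficients `½(H + λ⋆)⁻¹g`

Toward the deciding crux `VirialFluxGap.PeriodicSoftness` (item stmt-QuantumFields-24141), generic-region Euler field
`X_g = Σ_j φ_j ∂_j`, `φ = ½(H + λ⋆·1)⁻¹g` in the right-translation frame (✓`VirialFluxGapResolventFieldMatrix`).  The «EulerField»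
hypothesis of ✓`EulerFieldReduction.periodicSoftness_of_eulerField` wants, for every frame curve, `HasDerivAt (s ↦ φ_j(x·γ_i(s)))`
and the value of `Σ_i ∂_iφ_i`.  Along ONE curve the data are real functions of one variable: `s ↦ H(s)` (the symmetrised Hessian at
the moving point, entrywise differentiable at `0` with derivative `H′`), `s ↦ g(s)` (the gradient, derivative `g′`), `A(s) = H(s) + λ⋆·1`
with a positive floor at `s = 0`.  This file proves, with NO normed-algebra calculus (adjugate ∕ determinant ∕ product rule only):

* §1 `differentiableAt_det` ∕ `differentiableAt_adjugate` ∕ `differentiableAt_inv_entry` — the entries of `A(s)⁻¹` are differentiable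
  at `0` (determinant and adjugate are polynomials in the entries; `det A(0) ≠ 0`);
* §2 ★ `hasDerivAt_inv_entry` — the VALUE: `d/ds A(s)⁻¹|₀ = −A⁻¹H′A⁻¹` (differentiate `A(s)A(s)⁻¹ = 1`, valid near `0`);
* §3 ★★ `hasDerivAt_resolvent_coeff` — `d/ds [½(A(s)⁻¹g(s))_j]|₀ = ½[(A⁻¹g′)_j − (A⁻¹H′A⁻¹g)_j]`;
* §4 ★★ `sum_deriv_resolvent_coeff` — THE DIVERGENCE IDENTITY: if along direction `i` the gradient's derivative is `(g′_i)_j = H_ij + N_ij`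
  with `N` ANTISYMMETRIC (the structure-constant part `½[∂_i,∂_j]F₀`), then
  `Σ_i ½[(A⁻¹g′_i)_i − (A⁻¹H′_iA⁻¹g)_i] = ½tr(A⁻¹H) − ½Σ_i(A⁻¹H′_iA⁻¹g)_i` — the left side of ✓`ResolventField.divergence_upper`.

HONEST FRAMING: helper calculus; the frame data of the ring deficit (`H`, `g`, `H′_i` as functions on Ω_L with their derivative bounds),
the kernel family and the central charts are NOT here; ⟨24141⟩ stays OPEN; no stub / crux / rung / summit is closed; the Yang–Mills mass
gap is NOT proved; no summit is proved by a line.  THEOREMS ONLY (0 `def`, 0 `sorry`), standard axioms.  Explicit-unit seat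
`ym-line-fcl-p3` g40 (cell ym-idea-1, free hands), `--supports stmt-QuantumFields-24141`.
References: [folklore] (Jacobi ∕ Cramer: derivative of the inverse matrix).
-/

set_option autoImplicit false

open Matrix
open scoped BigOperators Topology

namespace Summit.QuantumFields.YangMills.Theorems.VirialFluxGap.ResolventField

variable {ι : Type*} [Fintype ι] [DecidableEq ι]

/-! ## §1 Entries of `A(s)⁻¹` are differentiable -/

/-- The determinant of an entrywise-differentiable matrix function is differentiable. [folklore] -/
theorem differentiableAt_det {As : ℝ → Matrix ι ι ℝ} {s₀ : ℝ}
    (hA : ∀ j k, DifferentiableAt ℝ (fun s => As s j k) s₀) :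
    DifferentiableAt ℝ (fun s => (As s).det) s₀ := by
  have h : (fun s => (As s).det) = fun s => ∑ σ : Equiv.Perm ι, ((Equiv.Perm.sign σ : ℤ) : ℝ) * ∏ i, As s (σ i) i := by
    funext s; rw [Matrix.det_apply']
  rw [h]
  refine DifferentiableAt.fun_sum fun σ _ => ?_
  refine DifferentiableAt.const_mul ?_ _
  exact DifferentiableAt.fun_finsetProd fun i _ => hA (σ i) i

/-- The adjugate of an entrywise-differentiable matrix function is entrywise differentiable. [folklore] -/
theorem differentiableAt_adjugate {As : ℝ → Matrix ι ι ℝ} {s₀ : ℝ}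
    (hA : ∀ j k, DifferentiableAt ℝ (fun s => As s j k) s₀) (j k : ι) :
    DifferentiableAt ℝ (fun s => (As s).adjugate j k) s₀ := by
  have h : (fun s => (As s).adjugate j k) = fun s => ((As s).updateRow k (Pi.single j 1)).det := by
    funext s; rw [Matrix.adjugate_apply]
  rw [h]
  refine differentiableAt_det (As := fun s => (As s).updateRow k (Pi.single j 1)) fun r c => ?_
  by_cases hr : r = k
  · subst hr
    simp only [Matrix.updateRow_self]
    exact differentiableAt_const _
  · simp only [Matrix.updateRow_ne hr]
    exact hA r c

/-- Near a point where `det A ≠ 0`, the entries of `A(s)⁻¹ = (det A(s))⁻¹ • adj A(s)` are differentiable. [folklore] -/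
theorem differentiableAt_inv_entry {As : ℝ → Matrix ι ι ℝ} {s₀ : ℝ}
    (hA : ∀ j k, DifferentiableAt ℝ (fun s => As s j k) s₀) (hdet : (As s₀).det ≠ 0) (j k : ι) :
    DifferentiableAt ℝ (fun s => (As s)⁻¹ j k) s₀ := by
  have h : (fun s => (As s)⁻¹ j k) = fun s => ((As s).det)⁻¹ * (As s).adjugate j k := by
    funext s
    rw [Matrix.inv_def, Ring.inverse_eq_inv', Matrix.smul_apply, smul_eq_mul]
  rw [h]
  exact ((differentiableAt_det hA).inv hdet).mul (differentiableAt_adjugate hA j k)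

/-! ## §2 The value of the derivative of the inverse -/

/-- `det A(s) ≠ 0` for `s` near `s₀` when it holds at `s₀` and the entries are differentiable (hence continuous). [folklore] -/
theorem eventually_det_ne_zero {As : ℝ → Matrix ι ι ℝ} {s₀ : ℝ}
    (hA : ∀ j k, DifferentiableAt ℝ (fun s => As s j k) s₀) (hdet : (As s₀).det ≠ 0) :
    ∀ᶠ s in 𝓝 s₀, (As s).det ≠ 0 :=
  (differentiableAt_det hA).continuousAt.eventually_ne hdet

/-- ★ JACOBI'S FORMULA (matrix form).  If the entries of `A(s)` have derivatives `A′` at `s₀` and `det A(s₀) ≠ 0`, then the entries of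
`A(s)⁻¹` have derivatives at `s₀` given by `−A⁻¹A′A⁻¹` (`A = A(s₀)`). [folklore] -/
theorem hasDerivAt_inv_entry {As : ℝ → Matrix ι ι ℝ} {A' : Matrix ι ι ℝ} {s₀ : ℝ}
    (hA : ∀ j k, HasDerivAt (fun s => As s j k) (A' j k) s₀) (hdet : (As s₀).det ≠ 0) (j k : ι) :
    HasDerivAt (fun s => (As s)⁻¹ j k) ((-((As s₀)⁻¹ * A' * (As s₀)⁻¹)) j k) s₀ := by
  have hAd : ∀ j k, DifferentiableAt ℝ (fun s => As s j k) s₀ := fun j k => (hA j k).differentiableAt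
  -- the (unknown) derivatives `D l k` of the inverse entries
  set D : Matrix ι ι ℝ := fun l k => deriv (fun s => (As s)⁻¹ l k) s₀ with hD
  have hDl : ∀ l k, HasDerivAt (fun s => (As s)⁻¹ l k) (D l k) s₀ := fun l k =>
    (differentiableAt_inv_entry hAd hdet l k).hasDerivAt
  -- differentiate `Σ_l A(s) j l · A(s)⁻¹ l k = δ_jk` (valid near `s₀`)
  have key : ∀ j k, (A' * (As s₀)⁻¹ + As s₀ * D) j k = 0 := by
    intro j k
    have h1 : HasDerivAt (fun s => ∑ l, As s j l * (As s)⁻¹ l k) (∑ l, (A' j l * (As s₀)⁻¹ l k + As s₀ j l * D l k)) s₀ :=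
      HasDerivAt.fun_sum fun l _ => (hA j l).mul (hDl l k)
    have h2 : HasDerivAt (fun s => ∑ l, As s j l * (As s)⁻¹ l k) 0 s₀ := by
      have hconst : HasDerivAt (fun _ : ℝ => (1 : Matrix ι ι ℝ) j k) 0 s₀ := hasDerivAt_const _ _
      refine hconst.congr_of_eventuallyEq ?_
      filter_upwards [eventually_det_ne_zero hAd hdet] with s hs
      have hmul : As s * (As s)⁻¹ = 1 := Matrix.mul_nonsing_inv _ (isUnit_iff_ne_zero.2 hs)
      have := congr_fun (congr_fun hmul j) k
      rw [Matrix.mul_apply] at this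
      exact this
    have h12 := h1.unique h2
    rw [Matrix.add_apply, Matrix.mul_apply, Matrix.mul_apply, ← Finset.sum_add_distrib]
    exact h12
  have hunit : IsUnit (As s₀).det := isUnit_iff_ne_zero.2 hdet
  have hDval : D = -((As s₀)⁻¹ * A' * (As s₀)⁻¹) := by
    have hmat : A' * (As s₀)⁻¹ + As s₀ * D = 0 := by ext j k; rw [key j k]; rfl
    have : (As s₀)⁻¹ * (A' * (As s₀)⁻¹ + As s₀ * D) = 0 := by rw [hmat, Matrix.mul_zero]
    rw [Matrix.mul_add, ← Matrix.mul_assoc, ← Matrix.mul_assoc, Matrix.nonsing_inv_mul _ hunit, Matrix.one_mul] at this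
    rw [← sub_eq_zero, sub_neg_eq_add, add_comm]
    exact this
  have := hDl j k
  rw [hDval] at this
  exact this

/-! ## §3 The derivative of the resolvent coefficients -/

/-- ★★ THE RESOLVENT COEFFICIENT ALONG A CURVE.  If the entries of the Hessian function `H(s)` have derivatives `H′` at `s₀`, the gradient
function `g(s)` has derivative `g′`, and `A(s₀) = H(s₀) + λ⋆·1` has a positive floor, then the coefficient
`φ_j(s) = ½·(A(s)⁻¹ g(s))_j` has derivative `½·[(A⁻¹g′)_j − (A⁻¹H′A⁻¹g)_j]` at `s₀` (`A`, `g` evaluated at `s₀`). [folklore] -/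
theorem hasDerivAt_resolvent_coeff {Hs : ℝ → Matrix ι ι ℝ} {H' : Matrix ι ι ℝ} {gs : ℝ → ι → ℝ} {g' : ι → ℝ} {s₀ lam c : ℝ}
    (hH : ∀ j k, HasDerivAt (fun s => Hs s j k) (H' j k) s₀) (hg : ∀ k, HasDerivAt (fun s => gs s k) (g' k) s₀) (hc : 0 < c)
    (hfl : ∀ v, c * (v ⬝ᵥ v) ≤ v ⬝ᵥ ((Hs s₀ + lam • (1 : Matrix ι ι ℝ)) *ᵥ v)) (j : ι) :
    HasDerivAt (fun s => (1 / 2 : ℝ) * (((Hs s + lam • (1 : Matrix ι ι ℝ))⁻¹ *ᵥ gs s) j))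
      ((1 / 2 : ℝ) * ((((Hs s₀ + lam • (1 : Matrix ι ι ℝ))⁻¹ *ᵥ g') j) -
        (((Hs s₀ + lam • (1 : Matrix ι ι ℝ))⁻¹ *ᵥ (H' *ᵥ ((Hs s₀ + lam • (1 : Matrix ι ι ℝ))⁻¹ *ᵥ gs s₀))) j))) s₀ := by
  set As : ℝ → Matrix ι ι ℝ := fun s => Hs s + lam • (1 : Matrix ι ι ℝ) with hAs
  have hA : ∀ j k, HasDerivAt (fun s => As s j k) (H' j k) s₀ := by
    intro j k
    have : (fun s => As s j k) = fun s => Hs s j k + lam * (1 : Matrix ι ι ℝ) j k := by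
      funext s; simp [hAs, Matrix.add_apply, Matrix.smul_apply]
    rw [this]
    simpa using (hH j k).add_const (lam * (1 : Matrix ι ι ℝ) j k)
  have hdet : (As s₀).det ≠ 0 := (isUnit_det_of_floor hc hfl).ne_zero
  have hinv := hasDerivAt_inv_entry hA hdet
  -- `(A(s)⁻¹ g(s))_j = Σ_k A(s)⁻¹ j k · g(s) k`
  have hφ : HasDerivAt (fun s => ((As s)⁻¹ *ᵥ gs s) j)
      (∑ k, ((-((As s₀)⁻¹ * H' * (As s₀)⁻¹)) j k * gs s₀ k + (As s₀)⁻¹ j k * g' k)) s₀ := by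
    have : (fun s => ((As s)⁻¹ *ᵥ gs s) j) = fun s => ∑ k, (As s)⁻¹ j k * gs s k := by
      funext s; rfl
    rw [this]
    exact HasDerivAt.fun_sum fun k _ => (hinv j k).mul (hg k)
  have hval : ∑ k, ((-((As s₀)⁻¹ * H' * (As s₀)⁻¹)) j k * gs s₀ k + (As s₀)⁻¹ j k * g' k) =
      ((As s₀)⁻¹ *ᵥ g') j - ((As s₀)⁻¹ *ᵥ (H' *ᵥ ((As s₀)⁻¹ *ᵥ gs s₀))) j := by
    rw [Finset.sum_add_distrib]
    have e1 : ∑ k, (-((As s₀)⁻¹ * H' * (As s₀)⁻¹)) j k * gs s₀ k = -(((As s₀)⁻¹ *ᵥ (H' *ᵥ ((As s₀)⁻¹ *ᵥ gs s₀))) j) := by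
      rw [Matrix.mulVec_mulVec, Matrix.mulVec_mulVec, Matrix.mul_assoc]
      simp only [Matrix.neg_apply, neg_mul, Finset.sum_neg_distrib, Matrix.mulVec, dotProduct, ← Matrix.mul_assoc]
    have e2 : ∑ k, (As s₀)⁻¹ j k * g' k = ((As s₀)⁻¹ *ᵥ g') j := rfl
    rw [e1, e2]; ring
  rw [hval] at hφ
  exact hφ.const_mul (1 / 2 : ℝ)

/-! ## §4 The divergence identity -/

omit [DecidableEq ι] in
/-- A symmetric matrix pairs to zero with an antisymmetric one: `Σ_ij S_ij N_ij = 0`. [folklore] -/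
theorem sum_symm_mul_antisymm {S N : Matrix ι ι ℝ} (hS : Sᵀ = S) (hN : Nᵀ = -N) :
    ∑ i, ∑ j, S i j * N i j = 0 := by
  have h : ∑ i, ∑ j, S i j * N i j = ∑ i, ∑ j, S j i * N j i := by rw [Finset.sum_comm]
  have h2 : ∑ i, ∑ j, S j i * N j i = -∑ i, ∑ j, S i j * N i j := by
    rw [← Finset.sum_neg_distrib]
    refine Finset.sum_congr rfl fun i _ => ?_
    rw [← Finset.sum_neg_distrib]
    refine Finset.sum_congr rfl fun j _ => ?_
    have hs : S j i = S i j := by rw [← Matrix.transpose_apply S i j, hS]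
    have hn : N j i = -N i j := by rw [← Matrix.transpose_apply N i j, hN, Matrix.neg_apply]
    rw [hs, hn]; ring
  linarith

/-- ★★ THE DIVERGENCE IDENTITY.  Let `A = H + λ⋆·1` with `Hᵀ = H`.  Suppose that along direction `i` the gradient's
derivative is `g′_i = (H + N) row i` with `N` antisymmetric — `(g′_i)_j = H_ij + N_ij`.  Then the frame divergence of the resolvent
coefficients is `Σ_i ½[(A⁻¹g′_i)_i − (A⁻¹H′_iA⁻¹g)_i] = ½·tr(A⁻¹H) − ½·Σ_i (A⁻¹H′_iA⁻¹g)_i`. [folklore] -/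
theorem sum_deriv_resolvent_coeff {H N : Matrix ι ι ℝ} (hH : Hᵀ = H) (hN : Nᵀ = -N) (lam : ℝ)
    (H' : ι → Matrix ι ι ℝ) (g : ι → ℝ) :
    ∑ i, (1 / 2 : ℝ) * ((((H + lam • (1 : Matrix ι ι ℝ))⁻¹ *ᵥ (fun j => H i j + N i j)) i) -
        (((H + lam • (1 : Matrix ι ι ℝ))⁻¹ *ᵥ (H' i *ᵥ ((H + lam • (1 : Matrix ι ι ℝ))⁻¹ *ᵥ g))) i)) =
      (1 / 2 : ℝ) * Matrix.trace ((H + lam • (1 : Matrix ι ι ℝ))⁻¹ * H) -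
        (1 / 2 : ℝ) * ∑ i, (((H + lam • (1 : Matrix ι ι ℝ))⁻¹ *ᵥ (H' i *ᵥ ((H + lam • (1 : Matrix ι ι ℝ))⁻¹ *ᵥ g))) i) := by
  set A := H + lam • (1 : Matrix ι ι ℝ) with hAdef
  have hB : A⁻¹ᵀ = A⁻¹ := transpose_inv_of_symm (transpose_shift hH lam)
  -- `Σ_i (A⁻¹ (H+N)_i·)_i = Σ_i Σ_j A⁻¹_ij (H_ij + N_ij) = tr(A⁻¹H) + 0`
  have h1 : ∑ i, (A⁻¹ *ᵥ (fun j => H i j + N i j)) i = Matrix.trace (A⁻¹ * H) := by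
    have e : ∑ i, (A⁻¹ *ᵥ (fun j => H i j + N i j)) i = (∑ i, ∑ j, A⁻¹ i j * H i j) + ∑ i, ∑ j, A⁻¹ i j * N i j := by
      rw [← Finset.sum_add_distrib]
      refine Finset.sum_congr rfl fun i _ => ?_
      rw [← Finset.sum_add_distrib]
      simp only [Matrix.mulVec, dotProduct, mul_add]
    rw [e, sum_symm_mul_antisymm hB hN, add_zero]
    simp only [Matrix.trace, Matrix.diag, Matrix.mul_apply]
    refine Finset.sum_congr rfl fun i _ => Finset.sum_congr rfl fun j _ => ?_
    rw [← Matrix.transpose_apply H j i, hH]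
  rw [← Finset.mul_sum, Finset.sum_sub_distrib, h1, mul_sub]

end Summit.QuantumFields.YangMills.Theorems.VirialFluxGap.ResolventField
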